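import Literature.NumberTheory.EllipticCurves.LangArtinSchreierCover
import Literature.NumberTheory.EllipticCurves.KohelShparlinskiCoordinateCharacters
import Literature.NumberTheory.DiophantineGeometry.FunctionFieldFundamentalEquality
import Literature.NumberTheory.DiophantineGeometry.FunctionFieldStepanovProofs
import Literature.NumberTheory.EllipticCurves.WeierstrassGeometricOrders
import Literature.NumberTheory.EllipticCurves.LangTorsorGeometric
import Literature.NumberTheory.EllipticCurves.FrobeniusSeparableProofs
import Literature.NumberTheory.EllipticCurves.IsogenyHomProofs
import Literature.NumberTheory.EllipticCurves.WeierstrassDivisorClassPoints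
import HarnessLib

/-!
# The decomposition of the places of `k(W)` in the Lang covering `φ - 1 : W → W`

Topic `NumberTheory/EllipticCurves`. Let `W` be an elliptic curve over the finite field `k`,
`K = k(W)`, `n = #W(k)`, and `L = LangCover W ⊇ K` the Lang covering of the tree
(`LangArtinSchreierCover`: the field `k(W)` itself made an extension of `K` through
`λ = (φ - 1)^*`, Galois with group the translations by `W(k)`). This file determines how the places
of `K` decompose in `L` — the geometric input of [KohelShparlinski2000, §2, Prop. 2] used by
`KohelShparlinskiCharacterSumsProofs` (hypothesis `hLang` of
`coordinateCharSumBound_of_langDecomposition`, and the fibre above `∞`):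

1. **Above `∞`** (`## The places of the Lang covering above the place at infinity`): the `n`
   translates `τ_T^* ∞` are all the places above `∞`, each rational, with `v(λ x) = -2`,
   `v(λ y) = -3` (`card_placesOver_infPlace`, `degree_eq_one_of_restrict_eq_infPlace`,
   `ord_algebraMap_xF/yF_of_restrict_eq_infPlace`);
2. **`λ` is the pull-back along the isogeny `ψ = φ - 1`** of the tree's isogeny theory on geometric
   points (`## The Lang covering and the isogeny φ - 1`): `pullbackHom_toGeom`, and the place of `L`
   at a geometric point `R` lies above the place of `K` at `ψ R` (`restrict_coverPlace`);
3. **The decomposition law of a finite place** (`## The decomposition of the finite places`): a place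
   `v ≠ ∞` of degree `d`, below the Frobenius orbit of `R ∈ E(k̄)` with orbit sum
   `T = Σ_{j<d} σ^j R = pt(v)` (`toGeomPoints_pointOfDivisor_single`), has exactly `n / ord(T)`
   places of `L` above it, each of degree `d · ord(T)` (`langDecomposition`).

Everything is proved; the definitions (`inftyL`, `transInfty`, `langIsogeny`) are genuine. The three parts below carry their own summaries and references.

## References

* D. R. Kohel, I. E. Shparlinski, *On exponential sums and group generators for elliptic curves over
  finite fields*, ANTS-IV, LNCS 1838 (2000), §2. [KohelShparlinski2000]
* J. H. Silverman, *The Arithmetic of Elliptic Curves*, 2nd ed., GTM 106, II.§2, III.2.3, III.4.8,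
  III.4.10(b), V.§1. [SilvermanAEC2009]
* H. Stichtenoth, *Algebraic Function Fields and Codes*, 2nd ed., GTM 254, Thm. 3.1.11, Lemma 3.5.2,
  Thm. 3.6.3, Prop. 6.1.7. [Stichtenoth2009]
-/

/-!
## The places of the Lang covering above the place at infinity

Topic `NumberTheory/EllipticCurves`. Let `W` be an elliptic curve over the finite field `k`,
`K = k(W)`, and `L = LangCover W ⊇ K` the Lang covering of the tree (`LangArtinSchreierCover`: the
field `k(W)` itself, made an extension of `K` through `λ = (φ - 1)^*`, Galois with group the
translations `τ_T`, `T ∈ W(k)`, `[L : K] = n = #W(k)`). This file determines the fibre of `L/K` above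
the place `∞` of `K`:

* `transl_gT_eq`, `transl_gT_sub_mul_sq` — the `x`-coordinate of `Q + U` for the generic point `Q`
  and an affine `U = (a, b) ∈ W(k)` (addition formula), and the identity
  `(τ_U x - a)(x - a)² = c₁ x + c₂ y + c₃` with `cᵢ ∈ k`;
* `transl_gT_mem_infPlace` — hence **`τ_U x` is regular at `∞` for `U ≠ O`** (`x ∘ t_U` has its poles
  at `-U ≠ O`), so `τ_U` moves the place `∞` (`comapRingEquiv_transl_inftyL_ne`);
* `transInfty W T` — the `n` translates `τ_T^* ∞` of the place `∞` of `L`; they lie above `∞_K`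
  (`restrict_transInfty`), are pairwise distinct (`transInfty_injective`), and at each of them
  `λ x` has a pole of order `2` and `λ y` a pole of order `3` (`ord_transInfty_algebraMap`);
* **`card_placesOver_infPlace`, `degree_eq_one_of_restrict_eq_infPlace`,
  `exists_transInfty_eq_of_restrict_eq_infPlace`, `ord_algebraMap_xF_of_restrict_eq_infPlace`,
  `ord_algebraMap_yF_of_restrict_eq_infPlace`** — by the fundamental equality
  `Σ_{w | ∞} e(w|∞) deg w = [L : K] = n` these `n` rational places are ALL the places of `L` above
  `∞_K`, each unramified of degree `1`: `∞` splits completely in the Lang covering, and `λ x`, `λ y`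
  have poles of order `2`, `3` at every place above `∞`.

This is the part "above `∞`" of the decomposition of places in the Lang covering used in
[KohelShparlinski2000, §2] (the `n` points of `(φ - 1)⁻¹(O) = W(k)`). Everything is proved; no named
facts; the one definition (`transInfty`) is genuine.

## References

* D. R. Kohel, I. E. Shparlinski, *On exponential sums and group generators for elliptic curves over
  finite fields*, ANTS-IV, LNCS 1838 (2000), §2. [KohelShparlinski2000]
* J. H. Silverman, *The Arithmetic of Elliptic Curves*, 2nd ed., GTM 106, III.2.3 (group law),
  III.4.10(b). [SilvermanAEC2009]
* H. Stichtenoth, *Algebraic Function Fields and Codes*, 2nd ed., GTM 254, Lemma 3.5.2, Thm. 3.1.11.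
  [Stichtenoth2009]
-/

noncomputable section

open scoped Classical
open Polynomial WeierstrassCurve WeierstrassCurve.Affine

namespace Literature.NumberTheory.EllipticCurves.KohelShparlinski

open Literature.NumberTheory.DiophantineGeometry Literature.NumberTheory.DiophantineGeometry.AlgFunctionField
open Literature.NumberTheory.EllipticCurves.HasseManin Literature.NumberTheory.EllipticCurves.LangTorsor
open WeierstrassPlaceAtInfinity WeierstrassFunctionField

universe u

variable {F : Type u} [Field F] (W : WeierstrassCurve F) [W.IsElliptic] [DecidableEq F]

/-! ### The `x`-coordinate of `Q + U` and its regularity at `∞` -/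

/-- **`τ_U x` by the addition formula**: for an affine `U = (a, b) ∈ W(k)`, `τ_U x = x(Q + U)` is
`ℓ² + a₁ ℓ - a₂ - x - a` with `ℓ = (y - b)/(x - a)` (`Q = (x, y)` the generic point).
[cite: SilvermanAEC2009, III.2.3] -/
theorem transl_gT_eq {a b : F} (hab : W.toAffine.Nonsingular a b) :
    transl (.some a b hab) (gT W) =
      (W.baseChange W.toAffine.FunctionField).toAffine.addX (gT W) (algebraMap F _ a)
        ((W.baseChange W.toAffine.FunctionField).toAffine.slope (gT W) (algebraMap F _ a) (gS W)
          (algebraMap F _ b)) := by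
  have hne : gT W ≠ algebraMap F W.toAffine.FunctionField a := fun h =>
    gT_not_mem_range (W := W) ⟨a, h.symm⟩
  have h1 : transl (.some a b hab) (gT W) = xc W (Point.map (transl (.some a b hab)) (genPt W)) := by
    rw [xc_map', xc_genPt]
  obtain ⟨h', hc⟩ : ∃ h', constPt W (.some a b hab) =
      .some (algebraMap F W.toAffine.FunctionField a) (algebraMap F W.toAffine.FunctionField b) h' :=
    ⟨_, rfl⟩
  rw [h1, map_transl_genPt, genPt_eq, hc, Point.add_of_X_ne hne]
  rfl

/-- **The key identity** `(τ_U x - a) · (x - a)² = c₁ x + c₂ y + c₃` with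
`c₁ = 3a² + 2a₂a + a₄ - a₁b`, `c₂ = -(2b + a₁a + a₃)`, `c₃ = 2a₆ + a₄a - a₃b - a³` (clear the
denominator of the addition formula and use the Weierstrass equations of `(x, y)` and of `(a, b)`).
[cite: SilvermanAEC2009, III.2.3] -/
theorem transl_gT_sub_mul_sq {a b : F} (hab : W.toAffine.Nonsingular a b) :
    (transl (.some a b hab) (gT W) - algebraMap F _ a) * (gT W - algebraMap F _ a) ^ 2 =
      algebraMap F W.toAffine.FunctionField (3 * a ^ 2 + 2 * W.a₂ * a + W.a₄ - W.a₁ * b) * gT W -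
        algebraMap F W.toAffine.FunctionField (2 * b + W.a₁ * a + W.a₃) * gS W +
        algebraMap F W.toAffine.FunctionField (2 * W.a₆ + W.a₄ * a - W.a₃ * b - a ^ 3) := by
  set C := algebraMap F W.toAffine.FunctionField with hC
  have hne : gT W ≠ C a := fun h => gT_not_mem_range (W := W) ⟨a, h.symm⟩
  have hd : gT W - C a ≠ 0 := sub_ne_zero.2 hne
  -- the two Weierstrass equations
  have heq1 : gS W ^ 2 + C W.a₁ * gT W * gS W + C W.a₃ * gS W =
      gT W ^ 3 + C W.a₂ * gT W ^ 2 + C W.a₄ * gT W + C W.a₆ := by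
    have h := equation_gT_gS W
    rw [Affine.equation_iff] at h
    simpa only [WeierstrassCurve.baseChange, map_a₁, map_a₂, map_a₃, map_a₄, map_a₆] using h
  have heq2 : C b ^ 2 + C W.a₁ * C a * C b + C W.a₃ * C b =
      C a ^ 3 + C W.a₂ * C a ^ 2 + C W.a₄ * C a + C W.a₆ := by
    have h := (Affine.equation_iff _ _).1 hab.1
    have h' := congrArg C h
    simpa only [map_add, map_mul, map_pow] using h'
  rw [transl_gT_eq W hab, Affine.slope_of_X_ne hne]
  simp only [Affine.addX, WeierstrassCurve.baseChange, map_a₁, map_a₂]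
  set ℓ := (gS W - C b) / (gT W - C a) with hℓ
  have hℓd : ℓ * (gT W - C a) = gS W - C b := div_mul_cancel₀ _ hd
  calc (ℓ ^ 2 + C W.a₁ * ℓ - C W.a₂ - gT W - C a - C a) * (gT W - C a) ^ 2
      = (ℓ * (gT W - C a)) ^ 2 + C W.a₁ * (ℓ * (gT W - C a)) * (gT W - C a) -
          (C W.a₂ + gT W + C a + C a) * (gT W - C a) ^ 2 := by ring
    _ = (gS W - C b) ^ 2 + C W.a₁ * (gS W - C b) * (gT W - C a) -
          (C W.a₂ + gT W + C a + C a) * (gT W - C a) ^ 2 := by rw [hℓd]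
    _ = _ := by
      simp only [map_add, map_sub, map_mul, map_pow, map_ofNat]
      linear_combination heq1 + heq2

/-- **`τ_U x ∈ 𝒪_∞` for `U ≠ O`**: the function `x ∘ t_U` is regular at `O` (its poles are at `-U`).
Valuation proof: with `u = x/y` (`v_∞(u) = 1`), `τ_U x - a = (c₁ x + c₂ y + c₃) u³ / ((x - a)² u³)`
where `c₁ x u³, c₂ y u³, c₃ u³ ∈ 𝒪_∞` and `v_∞((x - a)² u³) = -1`.
[cite: SilvermanAEC2009, III.4.10(b) and III.2.3] -/
theorem transl_gT_mem_infPlace {U : W.toAffine.Point} (hU : U ≠ 0) :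
    transl U (gT W) ∈ (infPlace W.toAffine).toValuationSubring := by
  rcases U with _ | ⟨a, b, hab⟩
  · exact absurd rfl hU
  set C := algebraMap F W.toAffine.FunctionField with hC
  set P := infPlace W.toAffine with hP
  have hx : P.ord (gT W) = -2 := ord_infPlace_xF W.toAffine
  have hy : P.ord (gS W) = -3 := ord_infPlace_yF W.toAffine
  have hx0 : gT W ≠ 0 := xF_ne_zero W.toAffine
  have hy0 : gS W ≠ 0 := yF_ne_zero W.toAffine
  set u : W.toAffine.FunctionField := gT W / gS W with hu
  have hu0 : u ≠ 0 := div_ne_zero hx0 hy0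
  have hordu : P.ord u = 1 := ord_infPlace_xF_div_yF W.toAffine
  have hu3 : u ^ 3 ≠ 0 := pow_ne_zero 3 hu0
  have hordu3 : P.ord (u ^ 3) = 3 := by rw [P.ord_pow hu0]; rw [hordu]; norm_num
  have hu_mem : u ^ 3 ∈ P.toValuationSubring :=
    (P.mem_toValuationSubring_iff_ord_nonneg hu3).2 (by rw [hordu3]; norm_num)
  have hxu : gT W * u ^ 3 ∈ P.toValuationSubring :=
    (P.mem_toValuationSubring_iff_ord_nonneg (mul_ne_zero hx0 hu3)).2
      (by rw [P.ord_mul_eq hx0 hu3, hx, hordu3]; norm_num)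
  have hyu : gS W * u ^ 3 ∈ P.toValuationSubring :=
    (P.mem_toValuationSubring_iff_ord_nonneg (mul_ne_zero hy0 hu3)).2
      (by rw [P.ord_mul_eq hy0 hu3, hy, hordu3]; norm_num)
  -- `v_∞(x - a) = -2`
  have hxa : P.ord (gT W - C a) = -2 ∧ gT W - C a ≠ 0 := by
    by_cases ha : a = 0
    · rw [ha, map_zero, sub_zero]; exact ⟨hx, hx0⟩
    · have hCa0 : -C a ≠ 0 := neg_ne_zero.2 ((map_ne_zero C).2 ha)
      have hCa : P.ord (-C a) = 0 := by rw [P.ord_neg, hC, ord_algebraMap_const P ha]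
      have h := P.ord_add_eq_left_of_lt hx0 hCa0 (by rw [hx, hCa]; norm_num)
      rw [← sub_eq_add_neg] at h
      exact ⟨h.2.trans hx, h.1⟩
  set D : W.toAffine.FunctionField := (gT W - C a) ^ 2 * u ^ 3 with hD
  have hD0 : D ≠ 0 := mul_ne_zero (pow_ne_zero 2 hxa.2) hu3
  have hordD : P.ord D = -1 := by
    rw [hD, P.ord_mul_eq (pow_ne_zero 2 hxa.2) hu3, P.ord_pow hxa.2, hxa.1, hordu3]; norm_num
  have hDinv : D⁻¹ ∈ P.toValuationSubring :=
    (P.mem_toValuationSubring_iff_ord_nonneg (inv_ne_zero hD0)).2 (by rw [P.ord_inv hD0, hordD]; norm_num)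
  -- the numerator times `u³` is integral at `∞`
  have hN : (transl (.some a b hab) (gT W) - C a) * (gT W - C a) ^ 2 * u ^ 3 ∈ P.toValuationSubring := by
    rw [transl_gT_sub_mul_sq W hab]
    have hrw : (C (3 * a ^ 2 + 2 * W.a₂ * a + W.a₄ - W.a₁ * b) * gT W - C (2 * b + W.a₁ * a + W.a₃) * gS W +
          C (2 * W.a₆ + W.a₄ * a - W.a₃ * b - a ^ 3)) * u ^ 3 =
        C (3 * a ^ 2 + 2 * W.a₂ * a + W.a₄ - W.a₁ * b) * (gT W * u ^ 3) -
          C (2 * b + W.a₁ * a + W.a₃) * (gS W * u ^ 3) +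
          C (2 * W.a₆ + W.a₄ * a - W.a₃ * b - a ^ 3) * u ^ 3 := by ring
    rw [hrw]
    exact add_mem (sub_mem (mul_mem (P.algebraMap_mem _) hxu) (mul_mem (P.algebraMap_mem _) hyu))
      (mul_mem (P.algebraMap_mem _) hu_mem)
  have heq : transl (.some a b hab) (gT W) =
      (transl (.some a b hab) (gT W) - C a) * (gT W - C a) ^ 2 * u ^ 3 * D⁻¹ + C a := by
    rw [show (transl (.some a b hab) (gT W) - C a) * (gT W - C a) ^ 2 * u ^ 3 * D⁻¹ =
        (transl (.some a b hab) (gT W) - C a) * (D * D⁻¹) by rw [hD]; ring,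
      mul_inv_cancel₀ hD0, mul_one, sub_add_cancel]
  rw [heq]
  exact add_mem (mul_mem hN hDinv) (P.algebraMap_mem _)

/-! ### The places `τ_T^* ∞` of the Lang covering -/

variable [Fintype F]

/-- The place `∞` of `k(W)`, as a place of the Lang covering `LangCover W` (the same field). [folklore] -/
def inftyL : PlaceOver F (LangCover W) := infPlace W.toAffine

omit [W.IsElliptic] [DecidableEq F] [Fintype F] in
/-- Membership in `inftyL` is membership in `𝒪_∞` (definitional). [folklore] -/
theorem mem_inftyL_iff (z : W.toAffine.FunctionField) :
    (LangCover.ofFun W z) ∈ (inftyL W).toValuationSubring ↔ z ∈ (infPlace W.toAffine).toValuationSubring :=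
  Iff.rfl

omit [W.IsElliptic] [DecidableEq F] [Fintype F] in
/-- Orders at `inftyL` are orders at `∞` (definitional). [folklore] -/
theorem ord_inftyL (z : W.toAffine.FunctionField) :
    (inftyL W).ord (LangCover.ofFun W z) = (infPlace W.toAffine).ord z :=
  rfl

/-- **`τ_U` moves `∞` for `U ≠ O`**: `τ_U^* ∞ ≠ ∞` (`x ∈ τ_U⁻¹ 𝒪_∞` by `transl_gT_mem_infPlace`, but
`x ∉ 𝒪_∞`). [cite: SilvermanAEC2009, III.4.10(b)] -/
theorem comapRingEquiv_transl_inftyL_eq_imp {U : W.toAffine.Point}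
    (h : (inftyL W).comapRingEquiv (LangCover.transl W U : LangCover W ≃+* LangCover W) = inftyL W) :
    U = 0 := by
  by_contra hU
  have hmem : LangCover.ofFun W (gT W) ∈
      ((inftyL W).comapRingEquiv (LangCover.transl W U : LangCover W ≃+* LangCover W)).toValuationSubring := by
    rw [PlaceOver.mem_comapRingEquiv_iff]
    change LangCover.transl W U (LangCover.ofFun W (gT W)) ∈ (inftyL W).toValuationSubring
    rw [LangCover.transl_apply]
    exact (mem_inftyL_iff W _).2 (by rw [translEquiv_apply]; exact transl_gT_mem_infPlace W hU)
  rw [h, mem_inftyL_iff] at hmem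
  have hx : (infPlace W.toAffine).ord (xF W.toAffine) = -2 := ord_infPlace_xF W.toAffine
  have h0 := ((infPlace W.toAffine).mem_toValuationSubring_iff_ord_nonneg (xF_ne_zero W.toAffine)).1 hmem
  rw [hx] at h0
  exact absurd h0 (by norm_num)

/-- **The translate `τ_T^* ∞`** of the place `∞` of the Lang covering: the place with valuation ring
`τ_T⁻¹(𝒪_∞)`. [cite: Stichtenoth2009, Lemma 3.5.2] -/
def transInfty (T : W.toAffine.Point) : PlaceOver F (LangCover W) :=
  (inftyL W).comapRingEquiv (LangCover.transl W T : LangCover W ≃+* LangCover W)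

/-- `∞_L` lies above `∞_K`: `λ x ∉ 𝒪_∞` (`v_∞(λ x) = -2`). [cite: KohelShparlinski2000, §2] -/
theorem restrict_inftyL :
    (inftyL W).restrict (K := F) (F := W.toAffine.FunctionField) = infPlace W.toAffine := by
  by_contra hne
  have hxmem := xF_mem_of_ne_infPlace (V := W.toAffine) hne
  rw [PlaceOver.mem_restrict_iff, LangCover.algebraMap_apply] at hxmem
  have h' : lam W (xF W.toAffine) ∈ (infPlace W.toAffine).toValuationSubring := (mem_inftyL_iff W _).1 hxmem
  have h0 := ((infPlace W.toAffine).mem_toValuationSubring_iff_ord_nonneg (lam_gT_ne_zero (W := W))).1 h'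
  rw [ord_infPlace_lam_gT] at h0
  exact absurd h0 (by norm_num)

/-- **`τ_T^* ∞` lies above `∞_K`** (`τ_T` is a `K`-automorphism of the covering).
[cite: Stichtenoth2009, Lemma 3.5.2] -/
theorem restrict_transInfty (T : W.toAffine.Point) :
    (transInfty W T).restrict (K := F) (F := W.toAffine.FunctionField) = infPlace W.toAffine := by
  rw [transInfty, PlaceOver.restrict_comapRingEquiv, restrict_inftyL]

/-- Membership in `τ_T^* ∞`: `z ∈ 𝒪 ↔ τ_T z ∈ 𝒪_∞`. [folklore] -/
theorem mem_transInfty_iff (T : W.toAffine.Point) (z : W.toAffine.FunctionField) :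
    LangCover.ofFun W z ∈ (transInfty W T).toValuationSubring ↔
      transl T z ∈ (infPlace W.toAffine).toValuationSubring := by
  rw [transInfty, PlaceOver.mem_comapRingEquiv_iff]
  change LangCover.transl W T (LangCover.ofFun W z) ∈ (inftyL W).toValuationSubring ↔ _
  rw [LangCover.transl_apply, mem_inftyL_iff, translEquiv_apply]
  rfl

/-- **The translates `τ_T^* ∞`, `T ∈ W(k)`, are pairwise distinct**: `τ_T^* ∞ = τ_{T'}^* ∞` forces
`τ_{T-T'}^* ∞ = ∞`, hence `T = T'`. [cite: KohelShparlinski2000, §2] -/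
theorem transInfty_injective : Function.Injective (transInfty W) := by
  intro T T' h
  have hiff : ∀ z : W.toAffine.FunctionField,
      transl T z ∈ (infPlace W.toAffine).toValuationSubring ↔
        transl T' z ∈ (infPlace W.toAffine).toValuationSubring := fun z => by
    rw [← mem_transInfty_iff, ← mem_transInfty_iff, h]
  have hinv : ∀ z : W.toAffine.FunctionField, transl T' (transl (-T') z) = z := fun z => by
    rw [← AlgHom.comp_apply, ← transl_add, add_neg_cancel, transl_zero, AlgHom.id_apply]
  have key : (inftyL W).comapRingEquiv (LangCover.transl W (T - T') : LangCover W ≃+* LangCover W) =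
      inftyL W := by
    apply PlaceOver.ext
    ext z
    rw [PlaceOver.mem_comapRingEquiv_iff]
    change LangCover.transl W (T - T') z ∈ (inftyL W).toValuationSubring ↔ z ∈ (inftyL W).toValuationSubring
    rw [LangCover.transl_apply, mem_inftyL_iff, translEquiv_apply, sub_eq_add_neg, transl_add,
      AlgHom.comp_apply, hiff, hinv]
    rfl
  exact sub_eq_zero.1 (comapRingEquiv_transl_inftyL_eq_imp W key)

/-- **Orders at `τ_T^* ∞` of functions from the base**: `v_{τ_T^* ∞}(λ h) = v_∞(λ h)` (`τ_T` fixes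
`λ(K)` pointwise). [cite: KohelShparlinski2000, §2] -/
theorem ord_transInfty_algebraMap (T : W.toAffine.Point) (h : W.toAffine.FunctionField) :
    (transInfty W T).ord (algebraMap W.toAffine.FunctionField (LangCover W) h) =
      (infPlace W.toAffine).ord (lam W h) := by
  rw [transInfty, PlaceOver.ord_comapRingEquiv, LangCover.algebraMap_apply]
  change (inftyL W).ord (LangCover.transl W T (LangCover.ofFun W (lam W h))) = _
  rw [LangCover.transl_apply]
  change (inftyL W).ord (LangCover.ofFun W (translEquiv T (lam W h))) = _
  rw [translEquiv_apply, transl_lam, ord_inftyL]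

/-! ### The fibre above `∞`: complete splitting -/

/-- **The places of the Lang covering above `∞_K` are exactly the `n` translates `τ_T^* ∞`, each of
degree `1` and unramified.** By the fundamental equality `Σ_{w | ∞} e(w|∞) · deg w = [L : K] · deg ∞ = n`
(`sum_ramification_mul_degree_eq`), while the `n` distinct places `τ_T^* ∞` above `∞` already
contribute at least `n`. Stated on the finite set of places above `∞`: it has `n` elements, and every
element has degree `1` and is a translate of `∞`. [cite: KohelShparlinski2000, §2]
[cite: Stichtenoth2009, Thm. 3.1.11] -/
theorem placesOver_infPlace_eq :
    ((infPlace W.toAffine).finite_setOf_restrict_eq (F' := LangCover W)).toFinset.card =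
        Nat.card W.toAffine.Point ∧
      ∀ w ∈ ((infPlace W.toAffine).finite_setOf_restrict_eq (F' := LangCover W)).toFinset,
        w.degree = 1 ∧ ∃ T : W.toAffine.Point, transInfty W T = w := by
  haveI : Finite W.toAffine.Point := finite_point
  haveI : Fintype W.toAffine.Point := Fintype.ofFinite _
  set K := W.toAffine.FunctionField
  set P := infPlace W.toAffine with hP
  set S := (P.finite_setOf_restrict_eq (F' := LangCover W)).toFinset with hSdef
  have hS : ∀ w : PlaceOver F (LangCover W), w ∈ S ↔ w.restrict (K := F) (F := K) = P := fun w =>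
    P.mem_toFinset_restrict_eq_iff (F' := LangCover W) w
  set n : ℕ := Nat.card W.toAffine.Point with hn
  have hncard : Fintype.card W.toAffine.Point = n := by rw [hn, Nat.card_eq_fintype_card]
  -- the orbit of `∞` injects into `S`
  set I : Finset (PlaceOver F (LangCover W)) := Finset.univ.image (transInfty W) with hI
  have hIS : I ⊆ S := by
    intro w hw
    obtain ⟨T, -, rfl⟩ := Finset.mem_image.1 hw
    exact (hS _).2 (restrict_transInfty W T)
  have hIcard : I.card = n := by
    rw [hI, Finset.card_image_of_injective _ (transInfty_injective W), Finset.card_univ, hncard]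
  have hcard_ge : n ≤ S.card := hIcard ▸ Finset.card_le_card hIS
  -- the fundamental equality
  set t : PlaceOver F (LangCover W) → ℤ := fun w =>
    w.ord (algebraMap K (LangCover W) (P.uniformizer : K)) * (w.degree : ℤ) with ht
  have hsum : ∑ w ∈ S, t w = n := by
    have h := PlaceOver.sum_ramification_mul_degree_eq (K := F) (F := K) (F' := LangCover W) P S hS
    rw [LangCover.finrank_eq, hP, degree_infPlace, Nat.cast_one, mul_one] at h
    exact h
  have hterm : ∀ w ∈ S, (1 : ℤ) ≤ t w := fun w hw => by
    have h1 : 1 ≤ w.ord (algebraMap K (LangCover W) (P.uniformizer : K)) := by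
      have := PlaceOver.one_le_ord_algebraMap_uniformizer (K := F) (F := K) w
      rwa [(hS w).1 hw] at this
    have h2 : (1 : ℤ) ≤ w.degree := by exact_mod_cast PlaceOver.degree_pos_holds w
    rw [ht]
    dsimp only
    nlinarith
  have hsum_ge : (S.card : ℤ) ≤ ∑ w ∈ S, t w := by
    have := Finset.card_nsmul_le_sum S t 1 hterm
    rwa [nsmul_eq_mul, mul_one] at this
  have hScard : S.card = n := by
    apply le_antisymm _ hcard_ge
    have : (S.card : ℤ) ≤ n := hsum ▸ hsum_ge
    exact_mod_cast this
  have hall : ∀ w ∈ S, t w = 1 := by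
    have h0 : ∑ w ∈ S, (t w - 1) = 0 := by
      rw [Finset.sum_sub_distrib, hsum, Finset.sum_const, nsmul_eq_mul, mul_one, hScard, sub_self]
    have h1 := (Finset.sum_eq_zero_iff_of_nonneg fun w hw => sub_nonneg.2 (hterm w hw)).1 h0
    intro w hw
    linarith [h1 w hw]
  have hIeqS : I = S := Finset.eq_of_subset_of_card_le hIS (by rw [hIcard, hScard])
  refine ⟨hScard, fun w hw => ⟨?_, ?_⟩⟩
  · have h1 : 1 ≤ w.ord (algebraMap K (LangCover W) (P.uniformizer : K)) := by
      have := PlaceOver.one_le_ord_algebraMap_uniformizer (K := F) (F := K) w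
      rwa [(hS w).1 hw] at this
    have htw := hall w hw
    rw [ht] at htw
    dsimp only at htw
    have hdeg : (w.degree : ℤ) = 1 := Int.eq_one_of_mul_eq_one_left (by omega) htw
    exact_mod_cast hdeg
  · rw [← hIeqS, hI, Finset.mem_image] at hw
    obtain ⟨T, -, hT⟩ := hw
    exact ⟨T, hT⟩

/-- **`∞` splits completely in the Lang covering**: there are `n = #W(k)` places above it.
[cite: KohelShparlinski2000, §2] -/
theorem card_placesOver_infPlace :
    ((infPlace W.toAffine).finite_setOf_restrict_eq (F' := LangCover W)).toFinset.card =
      Nat.card W.toAffine.Point :=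
  (placesOver_infPlace_eq W).1

/-- Every place of the Lang covering above `∞_K` is rational. [cite: KohelShparlinski2000, §2] -/
theorem degree_eq_one_of_restrict_eq_infPlace {w : PlaceOver F (LangCover W)}
    (hw : w.restrict (K := F) (F := W.toAffine.FunctionField) = infPlace W.toAffine) : w.degree = 1 :=
  ((placesOver_infPlace_eq W).2 w
    (((infPlace W.toAffine).mem_toFinset_restrict_eq_iff (F' := LangCover W) w).2 hw)).1

/-- Every place of the Lang covering above `∞_K` is a translate `τ_T^* ∞`. [cite: KohelShparlinski2000, §2] -/
theorem exists_transInfty_eq_of_restrict_eq_infPlace {w : PlaceOver F (LangCover W)}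
    (hw : w.restrict (K := F) (F := W.toAffine.FunctionField) = infPlace W.toAffine) :
    ∃ T : W.toAffine.Point, transInfty W T = w :=
  ((placesOver_infPlace_eq W).2 w
    (((infPlace W.toAffine).mem_toFinset_restrict_eq_iff (F' := LangCover W) w).2 hw)).2

/-- **`λ x` has a pole of order `2` at every place of the Lang covering above `∞_K`.**
[cite: KohelShparlinski2000, §2] -/
theorem ord_algebraMap_xF_of_restrict_eq_infPlace {w : PlaceOver F (LangCover W)}
    (hw : w.restrict (K := F) (F := W.toAffine.FunctionField) = infPlace W.toAffine) :
    w.ord (algebraMap W.toAffine.FunctionField (LangCover W) (xF W.toAffine)) = -2 := by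
  obtain ⟨T, rfl⟩ := exists_transInfty_eq_of_restrict_eq_infPlace W hw
  rw [ord_transInfty_algebraMap]
  exact ord_infPlace_lam_gT

/-- **`λ y` has a pole of order `3` at every place of the Lang covering above `∞_K`.**
[cite: KohelShparlinski2000, §2] -/
theorem ord_algebraMap_yF_of_restrict_eq_infPlace {w : PlaceOver F (LangCover W)}
    (hw : w.restrict (K := F) (F := W.toAffine.FunctionField) = infPlace W.toAffine) :
    w.ord (algebraMap W.toAffine.FunctionField (LangCover W) (yF W.toAffine)) = -3 := by
  obtain ⟨T, rfl⟩ := exists_transInfty_eq_of_restrict_eq_infPlace W hw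
  rw [ord_transInfty_algebraMap]
  exact ord_infPlace_lam_gS

end Literature.NumberTheory.EllipticCurves.KohelShparlinski

/-!
## The Lang covering and the isogeny `φ - 1`: places of `k(W)` below geometric points

Topic `NumberTheory/EllipticCurves`. Let `W` be an elliptic curve over the finite field `k`,
`K = k(W)`, `σ ∈ Γ_k` the arithmetic Frobenius, and `λ = (φ - 1)^* : K → K` the algebra structure
of the Lang covering `LangCover W ⊇ K` of the tree (`LangTorsorFrobenius`, `LangArtinSchreierCover`).
This file identifies `λ` with the pull-back along the isogeny `ψ = φ - 1 : E → E` of the tree's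
isogeny theory on geometric points (`Isogeny`, `FrobeniusEndomorphism`: `ψ R = σ R - R` on `E(k̄)`),
and deduces **which place of `K` lies below the place of a geometric point `R` in the Lang
covering**:

* `langIsogeny W hσ` — the isogeny `ψ = φ - 1 = -(1 - φ)` (`langIsogeny_apply : ψ R = σ • R - R`),
  its kernel `E(k)` (`langIsogeny_eq_zero_iff`, `natCard_ker_langIsogeny`);
* `map_toGeom_frobPt_eq_frobeniusPoint`, **`toGeom_lam_gT_gS`**: under
  `ι : k(W) → k̄(W)`, `λ x` and `λ y` are the coordinates of `-(1 - φ)(x, y)`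
  (`genericImage_oneSubFrobeniusIsogeny`), i.e. `ι(λ x) = ψ^* x`, `ι(λ y) = ψ^* y`
  (**`pullbackHom_toGeom`**: `ψ^* ∘ ι = ι ∘ λ`, by comparing values at infinitely many points);
* **`restrict_coverPlace`** (for the tree's `LangTorsorGeometric.coverPlace R`, the place `belowPlace R`
  typed as a place of `LangCover W`) — for every `R ∈ E(k̄)`, the place of the Lang covering at `R` lies above the place `belowPlace (ψ R)` of `K` (`v_R ∘ ψ^* = v_{ψ R}^{e}`, the tree's
  `Isogeny.placeVal_pullbackHom`).

This is the geometric input "(λ h)(R) = h(φ R - R)" of the decomposition of places in the Lang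
covering [KohelShparlinski2000, §2]. Everything is proved; the one definition (`langIsogeny`, a choice of the isogeny `-(1 - φ)`
provided by the tree) is genuine; `coverPlace` (the retyping of `belowPlace`) and the orbit-sum
invariance lemmas are the tree's (`LangTorsorGeometric`).

## References

* D. R. Kohel, I. E. Shparlinski, *On exponential sums and group generators for elliptic curves over
  finite fields*, ANTS-IV, LNCS 1838 (2000), §2. [KohelShparlinski2000]
* J. H. Silverman, *The Arithmetic of Elliptic Curves*, 2nd ed., GTM 106, II.§2 (`φ^* f = f ∘ φ`,
  `e_φ(P)`), III.4.8, V.§1 (`1 - φ`). [SilvermanAEC2009]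
-/

noncomputable section

open scoped Classical
open Polynomial WeierstrassCurve WeierstrassCurve.Affine WeierstrassCurve.geomPoints

namespace Literature.NumberTheory.EllipticCurves.KohelShparlinski

open Literature.NumberTheory.DiophantineGeometry Literature.NumberTheory.DiophantineGeometry.AlgFunctionField
open Literature.NumberTheory.EllipticCurves.HasseManin Literature.NumberTheory.EllipticCurves.LangTorsor
open Literature.NumberTheory.EllipticCurves.WeierstrassGeometricPlaces
open Literature.NumberTheory.EllipticCurves.WeierstrassFunctionField WeierstrassPlaceAtInfinity

universe u

variable {F : Type u} [Field F] [Fintype F] (W : WeierstrassCurve F) [W.IsElliptic]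
variable {σ : Field.absoluteGaloisGroup F} (hσ : ∀ x : AlgebraicClosure F, σ • x = x ^ Nat.card F)

/-! ### The isogeny `ψ = φ - 1` -/

include hσ in
/-- There is an isogeny `E → E` acting on `E(k̄)` as `R ↦ σ R - R` (the negative `-(1 - φ)` of the
tree's `oneSubFrobeniusIsogeny`, an isogeny by `Isogeny.exists_toAddMonoidHom_eq_neg`).
[cite: SilvermanAEC2009, V.§1 and III.§4] -/
theorem exists_isogeny_apply_eq_smul_sub :
    ∃ ψ : Isogeny W W, ∀ R : W.geomPoints, ψ R = σ • R - R := by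
  obtain ⟨χ, hχ⟩ := (W.oneSubFrobeniusIsogeny hσ).exists_toAddMonoidHom_eq_neg
  refine ⟨χ, fun R => ?_⟩
  have h := congrArg (fun f : W.geomPoints →+ W.geomPoints => f R) hχ
  simp only [AddMonoidHom.neg_apply, Isogeny.coe_toAddMonoidHom, oneSubFrobeniusIsogeny_apply,
    neg_sub] at h
  exact h

/-- **The isogeny `ψ = φ - 1 : E → E`** of the Lang covering, `ψ R = σ R - R` on geometric points
(a choice of the isogeny of `exists_isogeny_apply_eq_smul_sub`). [cite: KohelShparlinski2000, §2] -/
def langIsogeny : Isogeny W W := (exists_isogeny_apply_eq_smul_sub W hσ).choose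

/-- `ψ R = σ R - R`. [cite: KohelShparlinski2000, §2] -/
theorem langIsogeny_apply (R : W.geomPoints) : langIsogeny W hσ R = σ • R - R :=
  (exists_isogeny_apply_eq_smul_sub W hσ).choose_spec R

/-- `ψ R = -((1 - φ) R)`. [folklore] -/
theorem langIsogeny_eq_neg (R : W.geomPoints) :
    langIsogeny W hσ R = -(W.oneSubFrobeniusIsogeny hσ R) := by
  rw [langIsogeny_apply, oneSubFrobeniusIsogeny_apply, neg_sub]

/-- **`ker ψ = E(k)`**: `ψ R = O` iff `R` is `σ`-fixed iff `R` comes from `E(k)`.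
[cite: SilvermanAEC2009, proof of Thm. V.1.1] -/
theorem langIsogeny_eq_zero_iff (R : W.geomPoints) :
    langIsogeny W hσ R = 0 ↔ R ∈ Set.range W.toGeomPoints := by
  rw [langIsogeny_apply, sub_eq_zero, smul_eq_self_iff_mem_range_toGeomPoints hσ]

/-- `ψ (ι P) = O` for a rational point `P`. [folklore] -/
theorem langIsogeny_toGeomPoints (P : W.toAffine.Point) : langIsogeny W hσ (W.toGeomPoints P) = 0 :=
  (langIsogeny_eq_zero_iff W hσ _).2 ⟨P, rfl⟩

/-- The kernels of `ψ` and `1 - φ` coincide. [folklore] -/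
theorem ker_langIsogeny_eq :
    (langIsogeny W hσ).toAddMonoidHom.ker = (W.oneSubFrobeniusIsogeny hσ).toAddMonoidHom.ker := by
  ext R
  rw [AddMonoidHom.mem_ker, AddMonoidHom.mem_ker, Isogeny.coe_toAddMonoidHom, Isogeny.coe_toAddMonoidHom,
    langIsogeny_eq_neg, neg_eq_zero]

/-- **`#ker ψ = #E(k)`.** [cite: SilvermanAEC2009, proof of Thm. V.1.1] -/
theorem natCard_ker_langIsogeny :
    Nat.card (langIsogeny W hσ).toAddMonoidHom.ker = Nat.card W.toAffine.Point := by
  rw [ker_langIsogeny_eq, card_ker_oneSubFrobeniusIsogeny]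

/-- `ψ` commutes with `σ`. [folklore] -/
theorem langIsogeny_smul (τ : Field.absoluteGaloisGroup F) (R : W.geomPoints) :
    langIsogeny W hσ (τ • R) = τ • langIsogeny W hσ R :=
  (langIsogeny W hσ).map_smul τ R

/-! ### `ι ∘ λ` on the generators: the coordinates of `-(1 - φ)(x, y)` -/

/-- `ι` maps the Frobenius point `(x^q, y^q)` to `Frob_q (x, y)`. [folklore] -/
theorem map_toGeom_frobPt_eq_frobeniusPoint : Point.map (toGeom W) (frobPt W) = W.frobeniusPoint 1 W.genericPoint := by
  rw [frobeniusPoint_one_genericPoint]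
  unfold frobPt
  rw [Point.map_some]
  congr 1
  · rw [map_pow, Nat.card_eq_fintype_card]
    exact congrArg (· ^ Fintype.card F) (toGeom_xF W)
  · rw [map_pow, Nat.card_eq_fintype_card]
    exact congrArg (· ^ Fintype.card F) (toGeom_yF W)

/-- **`ι(λ x)` and `ι(λ y)` are the coordinates of `-(1 - φ)(x, y) ∈ W(k̄(W))`**: `λ` evaluates at
`(x^q, y^q) - (x, y)` (`map_lam_genPt`), `ι` is a homomorphism on points, and
`(x, y) - (x^q, y^q) = (1 - φ)(x, y)` is the generic value of `1 - φ`
(`genericImage_oneSubFrobeniusIsogeny`). [cite: KohelShparlinski2000, §2] -/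
theorem toGeom_lam_gT_gS :
    toGeom W (lam W (gT W)) = (W.oneSubFrobeniusIsogeny hσ).pullbackX ∧
      toGeom W (lam W (gS W)) = (W.baseChange W.geomFunctionField).toAffine.negY
        (W.oneSubFrobeniusIsogeny hσ).pullbackX (W.oneSubFrobeniusIsogeny hσ).pullbackY := by
  obtain ⟨h', e⟩ : ∃ h', Point.map (toGeom W) (Point.map (lam W) (genPt W)) =
      .some (toGeom W (lam W (gT W))) (toGeom W (lam W (gS W))) h' := ⟨_, rfl⟩
  have h2 : Point.map (toGeom W) (Point.map (lam W) (genPt W)) =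
      -(W.oneSubFrobeniusIsogeny hσ).genericImage := by
    rw [map_lam_genPt, map_sub, map_toGeom_frobPt_eq_frobeniusPoint, LangTorsorGeometric.map_toGeom_genPt,
      genericImage_oneSubFrobeniusIsogeny hσ]
    exact (neg_sub _ _).symm
  rw [h2] at e
  change -(Affine.Point.some (W.oneSubFrobeniusIsogeny hσ).pullbackX (W.oneSubFrobeniusIsogeny hσ).pullbackY
    (W.oneSubFrobeniusIsogeny hσ).nonsingular_pullback) = _ at e
  rw [Affine.Point.neg_some] at e
  obtain ⟨hx, hy⟩ := Affine.Point.some.inj e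
  exact ⟨hx.symm, hy.symm⟩

omit [Fintype F] [W.IsElliptic] in
/-- The coordinates of a negated affine geometric point. [folklore] -/
theorem xy_neg {R : W.geomPoints} (hR : R ≠ 0) :
    xy (-R) 0 = xy R 0 ∧
      xy (-R) 1 = (W.baseChange (AlgebraicClosure F)).toAffine.negY (xy R 0) (xy R 1) := by
  obtain ⟨a, b, h, rfl⟩ := geomPoints.exists_eq_some hR
  exact ⟨rfl, rfl⟩

/-- **`ψ^* x = ι(λ x)` and `ψ^* y = ι(λ y)`**: both sides are rational functions on `E_{k̄}` with the
values `x(σ R - R)`, `y(σ R - R)` at all but finitely many `R ∈ E(k̄)` (`ψ^* z` has the value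
`z(ψ R)`, Silverman II.§2; `ι(λ x), ι(λ y)` are the coordinates of `-(1 - φ)(x, y)` whose values are
those at `-(1 - φ)(R) = ψ R`), hence they are equal (`eq_of_infinite_setOf_hasValueAt`).
[cite: SilvermanAEC2009, II.§2] -/
theorem pullbackHom_genX_genY :
    (langIsogeny W hσ).pullbackHom W.genX = toGeom W (lam W (gT W)) ∧
      (langIsogeny W hσ).pullbackHom W.genY = toGeom W (lam W (gS W)) := by
  set ψ := langIsogeny W hσ with hψ
  set φ₁ := W.oneSubFrobeniusIsogeny hσ with hφ₁
  obtain ⟨hx, hy⟩ := toGeom_lam_gT_gS W hσ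
  rw [hx, hy, Isogeny.pullbackHom_genX, Isogeny.pullbackHom_genY]
  -- the good points
  set G : Set W.geomPoints := {R | AgreesWithRationalMapAt W W ψ.rationalRep.P₁ ψ.rationalRep.Q₁
      ψ.rationalRep.P₂ ψ.rationalRep.Q₂ ψ R ∧
    AgreesWithRationalMapAt W W φ₁.rationalRep.P₁ φ₁.rationalRep.Q₁ φ₁.rationalRep.P₂ φ₁.rationalRep.Q₂ φ₁ R}
    with hG
  have hGinf : G.Infinite := by
    have hfin := ψ.rationalRep.finite.union φ₁.rationalRep.finite
    refine hfin.infinite_compl.mono fun R hR => ?_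
    simp only [Set.mem_compl_iff, Set.mem_union, Set.mem_setOf_eq, not_or, not_not] at hR
    exact hR
  -- values at a good point
  have hval : ∀ R ∈ G, R ≠ 0 ∧ ψ R ≠ 0 ∧ φ₁ R ≠ 0 ∧ ψ R = -(φ₁ R) ∧
      W.HasValueAt ψ.pullbackX R (xy (ψ R) 0) ∧ W.HasValueAt ψ.pullbackY R (xy (ψ R) 1) ∧
      W.HasValueAt φ₁.pullbackX R (xy (φ₁ R) 0) ∧ W.HasValueAt φ₁.pullbackY R (xy (φ₁ R) 1) := by
    intro R hR
    obtain ⟨hRψ, hRφ⟩ := hR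
    obtain ⟨hR0, -, -, h', hψR⟩ := agreesWithRationalMapAt_iff.mp hRψ
    obtain ⟨-, -, -, h'', hφR⟩ := agreesWithRationalMapAt_iff.mp hRφ
    have hψ0 : ψ R ≠ 0 := by rw [hψR]; exact Affine.Point.some_ne_zero _
    have hφ0 : φ₁ R ≠ 0 := by rw [hφR]; exact Affine.Point.some_ne_zero _
    refine ⟨hR0, hψ0, hφ0, langIsogeny_eq_neg W hσ R, ?_, ?_, ?_, ?_⟩
    · simpa using ψ.hasValueAt_pullbackHom hRψ hψ0 (hasValueAt_gen (W := W) (ψ R) 0)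
    · simpa using ψ.hasValueAt_pullbackHom hRψ hψ0 (hasValueAt_gen (W := W) (ψ R) 1)
    · simpa using φ₁.hasValueAt_pullbackHom hRφ hφ0 (hasValueAt_gen (W := W) (φ₁ R) 0)
    · simpa using φ₁.hasValueAt_pullbackHom hRφ hφ0 (hasValueAt_gen (W := W) (φ₁ R) 1)
  constructor
  · apply eq_of_infinite_setOf_hasValueAt
    refine hGinf.mono fun R hR => ?_
    obtain ⟨hR0, -, hφ0, hneg, hvx, -, hvx', -⟩ := hval R hR
    refine ⟨hR0, xy (ψ R) 0, hvx, ?_⟩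
    rw [hneg, (xy_neg W hφ0).1]
    exact hvx'
  · apply eq_of_infinite_setOf_hasValueAt
    refine hGinf.mono fun R hR => ?_
    obtain ⟨hR0, -, hφ0, hneg, -, hvy, hvx', hvy'⟩ := hval R hR
    refine ⟨hR0, xy (ψ R) 1, hvy, ?_⟩
    rw [hneg, (xy_neg W hφ0).2]
    exact hvx'.negY hvy'

/-- **`ψ^* ∘ ι = ι ∘ λ`**: the pull-back along `ψ = φ - 1` restricted to `k(W) ⊆ k̄(W)` is the
algebra structure `λ` of the Lang covering. [cite: KohelShparlinski2000, §2] -/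
theorem pullbackHom_toGeom (h : W.toAffine.FunctionField) :
    (langIsogeny W hσ).pullbackHom (toGeom W h) = toGeom W (lam W h) := by
  have key : ((langIsogeny W hσ).pullbackHom.restrictScalars F).comp (toGeom W) =
      (toGeom W).comp (lam W) := by
    refine algHom_ext_xy (V := W.toAffine) ?_ ?_
    · change (langIsogeny W hσ).pullbackHom (toGeom W (xF W.toAffine)) = toGeom W (lam W (xF W.toAffine))
      rw [toGeom_xF]
      exact (pullbackHom_genX_genY W hσ).1
    · change (langIsogeny W hσ).pullbackHom (toGeom W (yF W.toAffine)) = toGeom W (lam W (yF W.toAffine))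
      rw [toGeom_yF]
      exact (pullbackHom_genX_genY W hσ).2
  exact congrArg (fun f => f h) key

/-! ### The place below a geometric point, in the Lang covering -/

open Literature.NumberTheory.EllipticCurves.LangTorsorGeometric (coverPlace mem_coverPlace_iff)

omit [Fintype F] in
/-- `coverPlace R` has the degree of `belowPlace R` (definitional). [folklore] -/
theorem degree_coverPlace (R : W.geomPoints) : (coverPlace W R).degree = (belowPlace W R).degree := rfl

omit [Fintype F] in
/-- **Every place of the Lang covering is the place at some geometric point.** [cite: SilvermanAEC2009, II.§2] -/
theorem exists_coverPlace_eq (w : PlaceOver F (LangCover W)) : ∃ R : W.geomPoints, coverPlace W R = w := by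
  obtain ⟨R, h⟩ := exists_belowPlace_eq W (show PlaceOver F W.toAffine.FunctionField from w)
  exact ⟨R, h⟩

omit [Fintype F] in
/-- `coverPlace R = coverPlace R'` iff `belowPlace R = belowPlace R'`. [folklore] -/
theorem coverPlace_eq_coverPlace_iff (R R' : W.geomPoints) :
    coverPlace W R = coverPlace W R' ↔ belowPlace W R = belowPlace W R' :=
  Iff.rfl

/-- **The place of the Lang covering at the geometric point `R` lies above the place of `K` at
`ψ R = σ R - R`.** For `h ∈ K`: `λ h` is regular at `R` iff `ψ^*(ι h)` is (by `pullbackHom_toGeom`)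
iff `ι h` is regular at `ψ R` (`v_R(ψ^* u) = v_{ψ R}(u)^{e_ψ(R)}`, Silverman II.§2).
[cite: KohelShparlinski2000, §2] [cite: SilvermanAEC2009, II.§2] -/
theorem restrict_coverPlace (R : W.geomPoints) :
    (coverPlace W R).restrict (K := F) (F := W.toAffine.FunctionField) = belowPlace W (langIsogeny W hσ R) := by
  set ψ := langIsogeny W hσ with hψ
  apply PlaceOver.ext
  ext h
  rw [PlaceOver.mem_restrict_iff, LangCover.algebraMap_apply, mem_coverPlace_iff, mem_belowPlace_iff,
    mem_belowPlace_iff, ← pullbackHom_toGeom W hσ h, mem_place_iff, mem_place_iff]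
  change W.placeVal R (ψ.pullbackHom (toGeom W h)) ≤ 1 ↔ W.placeVal (ψ R) (toGeom W h) ≤ 1
  rw [ψ.placeVal_pullbackHom R (toGeom W h)]
  exact pow_le_one_iff (ψ.ramificationIndex_pos R).ne'

/-- In particular the place at a geometric point `R` lies above `∞` iff `ψ R = O`, i.e. iff `R` is a
rational point. [cite: KohelShparlinski2000, §2] -/
theorem restrict_coverPlace_eq_infPlace_iff (R : W.geomPoints) :
    (coverPlace W R).restrict (K := F) (F := W.toAffine.FunctionField) = infPlace W.toAffine ↔
      langIsogeny W hσ R = 0 := by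
  rw [restrict_coverPlace W hσ R, belowPlace_eq_infPlace_iff]

end Literature.NumberTheory.EllipticCurves.KohelShparlinski

/-!
## The decomposition of the finite places of `k(W)` in the Lang covering

Topic `NumberTheory/EllipticCurves`. Let `W` be an elliptic curve over the finite field `k`,
`K = k(W)`, `n = #W(k)`, `σ` the arithmetic Frobenius, `ψ = φ - 1 : E → E` (`langIsogeny`) and
`L = LangCover W ⊇ K` the Lang covering (`λ = ψ^*`). A place `v ≠ ∞` of `K` of degree `d` is the
place below a Frobenius orbit `{R, σR, …, σ^{d-1}R} ⊆ E(k̄)` (`WeierstrassGeometricPlaces`); let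
`T = Σ_{j<d} σ^j R ∈ E(k)` be its orbit sum (`orbitSum`) and `f` the order of `T`. This file proves
the **decomposition law of `v` in `L`** [KohelShparlinski2000, §2]:

* `pow_smul_eq_self_iff` — `σ^j R = R ↔ d ∣ j` (`T` is `σ`-fixed and only depends on the orbit: the
  tree's `LangTorsorGeometric.smul_orbitSum`, `orbitSum_eq_of_belowPlace_eq`);
* `pow_smul_eq_add_sum` — for `ψ R' = R`: `σ^j R' = R' + Σ_{i<j} σ^i R`, whence
  **`pow_smul_eq_self_iff_of_langIsogeny`**: `σ^j R' = R' ↔ d f ∣ j`, and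
  **`degree_belowPlace_of_langIsogeny`**: the place below `R'` has degree `d · f`;
* `toGeomPoints_pointOfDivisor_single` — **`T = pt(v)`**, the rational point of the divisor `v`
  (`WeierstrassDivisorClassPoints.pointOfDivisor`), by the uniqueness of the Abel–Jacobi map
  (`addMonoidHom_divisor_ext`) and Abel's theorem over `k` (`sum_ord_smul_orbitSum_eq_zero`);
* **`langDecomposition`** — every place `w` of `L` above `v` has degree `ord(pt v) · deg v`, and
  there are exactly `n / ord(pt v)` of them: the places above `v` are the places below the points
  `R'` with `ψ R' ∈ orbit(R)` (`restrict_coverPlace`), these `n d` points (`ψ` is onto the orbit with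
  fibres cosets of `ker ψ = E(k)`) fall into Frobenius orbits of size `d f`, one for each place.

This is the hypothesis `hLang` of `coordinateCharSumBound_of_langDecomposition`
(`KohelShparlinskiWeilAssembly`). Everything is proved; no definitions; no named facts.

## References

* D. R. Kohel, I. E. Shparlinski, *On exponential sums and group generators for elliptic curves over
  finite fields*, ANTS-IV, LNCS 1838 (2000), §2 (the covering `φ - 1 : E → E` and the Frobenius of a
  place as the translation by the norm of a point above it). [KohelShparlinski2000]
* J.-P. Serre, *Algebraic Groups and Class Fields*, GTM 117, VI.§6 (Lang's isogeny). [Serre1988]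
* H. Stichtenoth, *Algebraic Function Fields and Codes*, 2nd ed., GTM 254, Thm. 3.6.3, Prop. 6.1.7.
  [Stichtenoth2009]
-/

noncomputable section

open scoped Classical
open Polynomial WeierstrassCurve WeierstrassCurve.Affine WeierstrassCurve.geomPoints

namespace Literature.NumberTheory.EllipticCurves.KohelShparlinski

open Literature.NumberTheory.DiophantineGeometry Literature.NumberTheory.DiophantineGeometry.AlgFunctionField
open Literature.NumberTheory.EllipticCurves.HasseManin Literature.NumberTheory.EllipticCurves.LangTorsor
open Literature.NumberTheory.EllipticCurves.WeierstrassGeometricPlaces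
open Literature.NumberTheory.EllipticCurves.WeierstrassGeometricOrders
open Literature.NumberTheory.EllipticCurves.WeierstrassFunctionField WeierstrassPlaceAtInfinity
open WeierstrassRationalPlaces WeierstrassDivisorClassPoints
open Literature.NumberTheory.EllipticCurves.LangTorsorGeometric (coverPlace mem_coverPlace_iff)

universe u

variable {F : Type u} [Field F] [Fintype F] (W : WeierstrassCurve F) [W.IsElliptic]
variable {σ : Field.absoluteGaloisGroup F} (hσ : ∀ x : AlgebraicClosure F, σ • x = x ^ Nat.card F)

/-! ### Frobenius periods of geometric points -/

include hσ in
/-- The arithmetic Frobenius in the normalisation `x ↦ x ^ Fintype.card k` of `LangTorsorGeometric`. [folklore] -/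
theorem smul_eq_pow_fintypeCard : ∀ x : AlgebraicClosure F, σ • x = x ^ Fintype.card F := fun x => by
  rw [← Nat.card_eq_fintype_card]; exact hσ x


include hσ in
/-- `σ^{deg v} R = R` for a geometric point `R ≠ O` above the place `v`. [cite: Stichtenoth2009, Thm. 3.6.3] -/
theorem pow_degree_smul {R : W.geomPoints} (hR : R ≠ 0) : (σ ^ (belowPlace W R).degree) • R = R := by
  obtain ⟨a, b, h, rfl⟩ := geomPoints.exists_eq_some hR
  exact pow_degree_smul_eq W σ hσ h

include hσ in
/-- **`σ^j R = R ↔ deg v ∣ j`**: the Frobenius period of a geometric point is the degree of the place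
below it. [cite: Stichtenoth2009, Thm. 3.6.3] -/
theorem pow_smul_eq_self_iff {R : W.geomPoints} (hR : R ≠ 0) (j : ℕ) :
    (σ ^ j) • R = R ↔ (belowPlace W R).degree ∣ j := by
  set d := (belowPlace W R).degree with hd
  have hdpos : 0 < d := PlaceOver.degree_pos_holds _
  have hper : (σ ^ d) • R = R := pow_degree_smul W hσ hR
  have hmul : ∀ m : ℕ, (σ ^ (d * m)) • R = R := fun m => by
    induction m with
    | zero => rw [mul_zero, pow_zero, one_smul]
    | succ m ih => rw [Nat.mul_succ, pow_add, mul_smul, hper, ih]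
  constructor
  · intro h
    have h1 : (σ ^ (j % d)) • R = R := by
      have e : (σ ^ j) • R = (σ ^ (j % d)) • ((σ ^ (d * (j / d))) • R) := by
        rw [← mul_smul, ← pow_add, Nat.mod_add_div]
      rw [hmul] at e
      exact e ▸ h
    obtain ⟨a, b, hab, rfl⟩ := geomPoints.exists_eq_some hR
    have hinj := pow_smul_injOn W σ hσ hab
    have h0 : j % d = 0 :=
      hinj (Set.mem_Iio.2 (Nat.mod_lt j hdpos)) (Set.mem_Iio.2 hdpos) (by simpa using h1)
    exact Nat.dvd_of_mod_eq_zero h0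
  · rintro ⟨m, rfl⟩
    exact hmul m

/-! ### The orbit sum -/

include hσ in
/-- `σ^j` fixes the orbit sum. [folklore] -/
theorem pow_smul_orbitSum {R : W.geomPoints} (hR : R ≠ 0) (j : ℕ) :
    (σ ^ j) • orbitSum W σ R = orbitSum W σ R := by
  induction j with
  | zero => rw [pow_zero, one_smul]
  | succ j ih => rw [pow_succ', mul_smul, ih, LangTorsorGeometric.smul_orbitSum W σ (smul_eq_pow_fintypeCard hσ) hR]

include hσ in
/-- **Shifted orbit sums**: `Σ_{i < n + d} σ^i R = Σ_{i<n} σ^i R + orbitSum R`. [folklore] -/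
theorem sum_range_add_degree {R : W.geomPoints} (hR : R ≠ 0) (n : ℕ) :
    ∑ i ∈ Finset.range (n + (belowPlace W R).degree), (σ ^ i) • R =
      (∑ i ∈ Finset.range n, (σ ^ i) • R) + orbitSum W σ R := by
  rw [Finset.sum_range_add]
  congr 1
  rw [← pow_smul_orbitSum W hσ hR n]
  unfold orbitSum
  rw [Finset.smul_sum]
  refine Finset.sum_congr rfl fun i _ => ?_
  rw [← mul_smul, ← pow_add]

include hσ in
/-- `Σ_{i < s + d m} σ^i R = Σ_{i<s} σ^i R + m · orbitSum R`. [folklore] -/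
theorem sum_range_add_mul_degree {R : W.geomPoints} (hR : R ≠ 0) (s m : ℕ) :
    ∑ i ∈ Finset.range (s + (belowPlace W R).degree * m), (σ ^ i) • R =
      (∑ i ∈ Finset.range s, (σ ^ i) • R) + m • orbitSum W σ R := by
  induction m with
  | zero => rw [mul_zero, add_zero, zero_smul, add_zero]
  | succ m ih =>
    rw [Nat.mul_succ, ← add_assoc, sum_range_add_degree W hσ hR, ih, succ_nsmul, add_assoc]

/-! ### Points of the Lang covering above an orbit -/

/-- **`σ^j R' = R' + Σ_{i<j} σ^i R`** when `ψ R' = σ R' - R' = R`. [cite: KohelShparlinski2000, §2] -/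
theorem pow_smul_eq_add_sum {R R' : W.geomPoints} (h : langIsogeny W hσ R' = R) (j : ℕ) :
    (σ ^ j) • R' = R' + ∑ i ∈ Finset.range j, (σ ^ i) • R := by
  have hR : σ • R' = R' + R := by
    rw [← h, langIsogeny_apply]; abel
  induction j with
  | zero => rw [pow_zero, one_smul, Finset.sum_range_zero, add_zero]
  | succ j ih =>
    rw [pow_succ', mul_smul, ih, smul_add, hR, Finset.smul_sum,
      Finset.sum_range_succ' (fun i => (σ ^ i) • R) j, pow_zero, one_smul]
    have : ∑ i ∈ Finset.range j, σ • (σ ^ i) • R = ∑ i ∈ Finset.range j, (σ ^ (i + 1)) • R :=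
      Finset.sum_congr rfl fun i _ => by rw [← mul_smul, ← pow_succ']
    rw [this]
    abel

/-- **The Frobenius period of a point `R'` with `ψ R' = R ≠ O` is `deg v_R · ord(orbitSum R)`**:
`σ^j R' = R' ↔ d f ∣ j`. [cite: KohelShparlinski2000, §2] -/
theorem pow_smul_eq_self_iff_of_langIsogeny {R R' : W.geomPoints} (h : langIsogeny W hσ R' = R)
    (hR : R ≠ 0) (j : ℕ) :
    (σ ^ j) • R' = R' ↔ (belowPlace W R).degree * addOrderOf (orbitSum W σ R) ∣ j := by
  set d := (belowPlace W R).degree with hd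
  set f := addOrderOf (orbitSum W σ R) with hf
  have hdpos : 0 < d := PlaceOver.degree_pos_holds _
  -- `σ^j R' = R' ↔ Σ_{i<j} σ^i R = 0`
  have hequiv : (σ ^ j) • R' = R' ↔ ∑ i ∈ Finset.range j, (σ ^ i) • R = 0 := by
    rw [pow_smul_eq_add_sum W hσ h j, add_eq_left]
  -- write `j = s + d m`
  obtain ⟨m, s, hs, hj⟩ : ∃ m s, s < d ∧ j = s + d * m :=
    ⟨j / d, j % d, Nat.mod_lt _ hdpos, (Nat.mod_add_div j d).symm⟩
  constructor
  · intro hfix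
    -- `σ^j` fixes `R = ψ R'`, so `d ∣ j`, so `s = 0`
    have hRfix : (σ ^ j) • R = R := by
      rw [← h, ← langIsogeny_smul, hfix]
    have hdj : d ∣ j := (pow_smul_eq_self_iff W hσ hR j).1 hRfix
    have hs0 : s = 0 := by
      have : d ∣ s := by
        have h1 : d ∣ s + d * m := hj ▸ hdj
        exact (Nat.dvd_add_left (Dvd.intro m rfl)).1 h1
      exact Nat.eq_zero_of_dvd_of_lt this hs
    -- then `m • T = 0`, so `f ∣ m`
    have hsum := hequiv.1 hfix
    rw [hj, sum_range_add_mul_degree W hσ hR s m, hs0, Finset.sum_range_zero, zero_add] at hsum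
    have hfm : f ∣ m := by rw [hf]; exact addOrderOf_dvd_of_nsmul_eq_zero hsum
    rw [hj, hs0, zero_add]
    exact Nat.mul_dvd_mul_left d hfm
  · intro hdvd
    rw [hequiv, hj, sum_range_add_mul_degree W hσ hR s m]
    have hds : d ∣ s := by
      have h1 : d ∣ s + d * m := hj ▸ dvd_trans (Dvd.intro f rfl) hdvd
      exact (Nat.dvd_add_left (Dvd.intro m rfl)).1 h1
    have hs0 : s = 0 := Nat.eq_zero_of_dvd_of_lt hds hs
    have hfm : f ∣ m := by
      have h1 : d * f ∣ d * m := by rw [hj, hs0, zero_add] at hdvd; exact hdvd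
      exact Nat.dvd_of_mul_dvd_mul_left hdpos h1
    rw [hs0, Finset.sum_range_zero, zero_add]
    obtain ⟨t, rfl⟩ := hfm
    rw [hf]
    exact addOrderOf_dvd_iff_nsmul_eq_zero.1 (Dvd.intro t rfl)

/-- **The place below `R'` with `ψ R' = R ≠ O` has degree `deg v_R · ord(orbitSum R)`** (both
numbers are the Frobenius period of `R'`). [cite: KohelShparlinski2000, §2] -/
theorem degree_belowPlace_of_langIsogeny {R R' : W.geomPoints} (h : langIsogeny W hσ R' = R)
    (hR : R ≠ 0) :
    (belowPlace W R').degree = (belowPlace W R).degree * addOrderOf (orbitSum W σ R) := by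
  have hR' : R' ≠ 0 := by
    rintro rfl
    rw [map_zero] at h
    exact hR h.symm
  have key : ∀ j : ℕ, (belowPlace W R').degree ∣ j ↔
      (belowPlace W R).degree * addOrderOf (orbitSum W σ R) ∣ j := fun j => by
    rw [← pow_smul_eq_self_iff W hσ hR' j, pow_smul_eq_self_iff_of_langIsogeny W hσ h hR j]
  exact Nat.dvd_antisymm ((key _).2 (dvd_refl _)) ((key _).1 (dvd_refl _))

/-! ### The orbit sum is the rational point of the divisor -/

omit [Fintype F] in
/-- **Uniqueness of the Abel–Jacobi map**: two homomorphisms out of `Div(k(W))` killing principal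
divisors and agreeing on the places of the rational points agree (every place `v` satisfies
`v ∼ P + (deg v - 1) ∞` for a rational `P`, `exists_principalDivisor_eq`).
[cite: Stichtenoth2009, Prop. 6.1.6(a) and Prop. 6.1.7(d)] -/
theorem addMonoidHom_divisor_ext {M : Type*} [AddCommGroup M]
    {Φ Ψ : Divisor F W.toAffine.FunctionField →+ M}
    (hΦ : ∀ x : W.toAffine.FunctionField, x ≠ 0 → Φ (principalDivisor F x) = 0)
    (hΨ : ∀ x : W.toAffine.FunctionField, x ≠ 0 → Ψ (principalDivisor F x) = 0)
    (hpt : ∀ P : W.toAffine.Point,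
      Φ (Finsupp.single (placeOfPoint W.toAffine P) 1) = Ψ (Finsupp.single (placeOfPoint W.toAffine P) 1)) :
    Φ = Ψ := by
  refine Finsupp.addHom_ext fun v n => ?_
  have hsingle : (Finsupp.single v n : Divisor F W.toAffine.FunctionField) = n • Finsupp.single v 1 := by
    rw [Finsupp.smul_single, smul_eq_mul, mul_one]
  rw [hsingle, map_zsmul, map_zsmul]
  congr 1
  obtain ⟨x, hx0, P, hx⟩ := exists_principalDivisor_eq (V := W.toAffine) v
  have hv : (Finsupp.single v 1 : Divisor F W.toAffine.FunctionField) =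
      Finsupp.single (placeOfPoint W.toAffine P) 1 +
        ((v.degree : ℤ) - 1) • Finsupp.single (infPlace W.toAffine) 1 - principalDivisor F x := by
    rw [hx]; abel
  rw [hv, map_sub, map_add, map_zsmul, map_sub, map_add, map_zsmul, hpt P, hΦ x hx0, hΨ x hx0,
    ← placeOfPoint_zero (V := W.toAffine), hpt 0]

omit [Fintype F] in
/-- **The place below the rational point `ι P` is the place of `P`.** [cite: SilvermanAEC2009, II.§2] -/
theorem belowPlace_toGeomPoints (P : W.toAffine.Point) :
    belowPlace W (W.toGeomPoints P) = placeOfPoint W.toAffine P := by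
  rcases P with _ | ⟨a, b, h⟩
  · show belowPlace W (W.toGeomPoints 0) = placeOfPoint W.toAffine 0
    rw [map_zero, belowPlace_zero]; rfl
  · obtain ⟨h', e⟩ : ∃ h', W.toGeomPoints (.some a b h) =
        (Affine.Point.some (algebraMap F (AlgebraicClosure F) a) (algebraMap F (AlgebraicClosure F) b) h' :
          W.geomPoints) := ⟨_, rfl⟩
    rw [e, belowPlace_some_eq_ofPrime, placeOfPoint_some]
    congr 1
    refine IsDedekindDomain.HeightOneSpectrum.ext ?_
    rw [pointPrime_asIdeal]
    symm
    refine Ideal.IsMaximal.eq_of_le (pointIdeal_isMaximal h.left)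
      (kerPrime W h').isPrime.ne_top fun r hr => ?_
    rw [mem_pointIdeal_iff h.left] at hr
    rw [mem_kerPrime_iff]
    obtain ⟨p, rfl⟩ := AdjoinRoot.mk_surjective r
    change evalBase W h' (Affine.CoordinateRing.mk W.toAffine p) = 0
    change pointEval h.left (Affine.CoordinateRing.mk W.toAffine p) = 0 at hr
    rw [pointEval_mk] at hr
    rw [evalBase_mk, Polynomial.map_mapRingHom_evalEval, hr, map_zero]

omit [Fintype F] in
/-- The orbit sum of a point above a rational place is the point. [folklore] -/
theorem orbitSum_eq_self_of_degree_eq_one {R : W.geomPoints} (h : (belowPlace W R).degree = 1) :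
    orbitSum W σ R = R := by
  unfold orbitSum
  rw [h, Finset.sum_range_one, pow_zero, one_smul]

include hσ in
/-- **The orbit sum of a point above `v` is the rational point `pt(v)` of the divisor `v`**
(`ι (pointOfDivisor (single v 1)) = Σ_{j<deg v} σ^j R`): the homomorphism
`D ↦ Σ_v D(v) · orbitSum(R_v)` kills principal divisors (Abel's theorem over `k`,
`sum_ord_smul_orbitSum_eq_zero`) and sends the place of a rational point `P` to `ι P`, as does
`ι ∘ pointOfDivisor`; by `addMonoidHom_divisor_ext` they agree. [cite: Stichtenoth2009, Prop. 6.1.7]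
[cite: SilvermanAEC2009, Cor. III.3.5] -/
theorem toGeomPoints_pointOfDivisor_single {R : W.geomPoints} (hR : R ≠ 0) :
    W.toGeomPoints (pointOfDivisor W.toAffine (Finsupp.single (belowPlace W R) 1)) = orbitSum W σ R := by
  -- a point above every place
  set pt : PlaceOver F W.toAffine.FunctionField → W.geomPoints := fun v => (exists_belowPlace_eq W v).choose
    with hpt
  have hptv : ∀ v, belowPlace W (pt v) = v := fun v => (exists_belowPlace_eq W v).choose_spec
  have hpt0 : ∀ v, v ≠ infPlace W.toAffine → pt v ≠ 0 := fun v hv h0 =>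
    hv ((hptv v).symm.trans ((belowPlace_eq_infPlace_iff W (pt v)).2 h0))
  set Q : PlaceOver F W.toAffine.FunctionField → W.geomPoints := fun v =>
    if v = infPlace W.toAffine then 0 else orbitSum W σ (pt v) with hQ
  set Φ : Divisor F W.toAffine.FunctionField →+ W.geomPoints :=
    Finsupp.liftAddHom fun v => zmultiplesHom W.geomPoints (Q v) with hΦ
  have hΦsingle : ∀ v (m : ℤ), Φ (Finsupp.single v m) = m • Q v := fun v m => by
    rw [hΦ, Finsupp.liftAddHom_apply_single, zmultiplesHom_apply]
  set Ψ : Divisor F W.toAffine.FunctionField →+ W.geomPoints :=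
    W.toGeomPoints.comp (pointOfDivisor W.toAffine) with hΨ
  have hQ_orbit : ∀ {S : W.geomPoints}, S ≠ 0 → Q (belowPlace W S) = orbitSum W σ S := by
    intro S hS
    have hne : belowPlace W S ≠ infPlace W.toAffine := belowPlace_ne_infPlace W hS
    rw [hQ]
    dsimp only
    rw [if_neg hne]
    exact LangTorsorGeometric.orbitSum_eq_of_belowPlace_eq W σ (smul_eq_pow_fintypeCard hσ) hS (hptv _)
  have key : Φ = Ψ := by
    refine addMonoidHom_divisor_ext W ?_ ?_ ?_
    · -- Abel over `k`
      intro x hx0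
      have hfin := finite_setOf_ord_ne_zero_holds (K := F) (F := W.toAffine.FunctionField) hx0
      have hexp : Φ (principalDivisor F x) =
          ∑ v ∈ (principalDivisor F x).support, (principalDivisor F x v) • Q v := by
        conv_lhs => rw [← Finsupp.sum_single (principalDivisor F x)]
        rw [Finsupp.sum, map_sum]
        exact Finset.sum_congr rfl fun v _ => hΦsingle v _
      have hinf0 : (principalDivisor F x (infPlace W.toAffine)) • Q (infPlace W.toAffine) = 0 := by
        rw [hQ]; dsimp only; rw [if_pos rfl, smul_zero]
      rw [hexp, ← Finset.sum_erase (f := fun v => (principalDivisor F x v) • Q v) _ hinf0]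
      have hterm : ∀ v ∈ (principalDivisor F x).support.erase (infPlace W.toAffine),
          (principalDivisor F x v) • Q v = v.ord x • orbitSum W σ (pt v) := by
        intro v hv
        have hvinf : v ≠ infPlace W.toAffine := Finset.ne_of_mem_erase hv
        rw [principalDivisor_apply hfin, hQ]
        dsimp only
        rw [if_neg hvinf]
      rw [Finset.sum_congr rfl hterm]
      refine sum_ord_smul_orbitSum_eq_zero W σ hσ hx0 _ pt (fun v hv => ?_) (fun v hv hord => ?_)
      · exact ⟨hpt0 v (Finset.ne_of_mem_erase hv), hptv v⟩
      · rw [Finset.mem_erase, Finsupp.mem_support_iff, principalDivisor_apply hfin]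
        exact ⟨hv, hord⟩
    · intro x hx0
      rw [hΨ, AddMonoidHom.comp_apply, pointOfDivisor_principalDivisor, map_zero]
    · intro P
      rw [hΦsingle, one_smul, hΨ, AddMonoidHom.comp_apply, pointOfDivisor_single_placeOfPoint, one_smul]
      rcases eq_or_ne P 0 with rfl | hP
      · rw [placeOfPoint_zero, map_zero, hQ]
        dsimp only
        rw [if_pos rfl]
      · have hP' : W.toGeomPoints P ≠ 0 := fun h0 => hP (toGeomPoints_injective W (by rw [h0, map_zero]))
        rw [← belowPlace_toGeomPoints W P, hQ_orbit hP']
        exact orbitSum_eq_self_of_degree_eq_one W (by rw [belowPlace_toGeomPoints]; exact degree_placeOfPoint P)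
  have h := DFunLike.congr_fun key (Finsupp.single (belowPlace W R) 1)
  rw [hΦsingle, one_smul, hQ_orbit hR, hΨ, AddMonoidHom.comp_apply] at h
  exact h.symm

include hσ in
/-- Hence `ord(orbitSum R) = ord(pt(v_R))` in `W(k)`. [folklore] -/
theorem addOrderOf_orbitSum {R : W.geomPoints} (hR : R ≠ 0) :
    addOrderOf (orbitSum W σ R) = addOrderOf (pointOfDivisor W.toAffine (Finsupp.single (belowPlace W R) 1)) := by
  rw [← toGeomPoints_pointOfDivisor_single W hσ hR]
  exact addOrderOf_injective W.toGeomPoints (toGeomPoints_injective W) _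

/-! ### The decomposition law -/

/-- **`ψ` maps onto every Frobenius orbit**: for `P ≠ O` there is `R'` with `ψ R' = P` (a place of
the Lang covering above the place of `P` is the place of some `R''`, which lies above the place of
`ψ R''`, a conjugate `σ^j P` of `P`; take `R' = σ^{-j} R''`). [cite: KohelShparlinski2000, §2] -/
theorem exists_langIsogeny_eq {P : W.geomPoints} (hP : P ≠ 0) : ∃ R' : W.geomPoints, langIsogeny W hσ R' = P := by
  obtain ⟨w, hw⟩ := (belowPlace W P).exists_restrict_eq' (F' := LangCover W)
  obtain ⟨R'', rfl⟩ := exists_coverPlace_eq W w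
  rw [restrict_coverPlace W hσ R''] at hw
  have hmem : langIsogeny W hσ R'' ∈ orbit W σ P := (mem_orbit_iff W σ hσ hP _).2 hw
  rw [orbit, Finset.mem_image] at hmem
  obtain ⟨j, -, hj⟩ := hmem
  refine ⟨(σ ^ j)⁻¹ • R'', ?_⟩
  rw [langIsogeny_smul, ← hj, inv_smul_smul]

/-- **The fibres of `ψ` have `#W(k)` elements** (cosets of `ker ψ = W(k)`). [cite: KohelShparlinski2000, §2] -/
theorem card_fibre_langIsogeny {P : W.geomPoints} (hP : P ≠ 0) :
    ((langIsogeny W hσ).finite_fibre P).toFinset.card = Nat.card W.toAffine.Point := by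
  obtain ⟨R₁, hR₁⟩ := exists_langIsogeny_eq W hσ hP
  rw [← natCard_ker_langIsogeny W hσ, ← Set.ncard_eq_toFinset_card _ ((langIsogeny W hσ).finite_fibre P),
    ← Nat.card_coe_set_eq]
  refine Nat.card_congr ?_
  refine
    { toFun := fun R' => ⟨R'.1 - R₁, by
        have h1 : langIsogeny W hσ R'.1 = P := R'.2
        rw [AddMonoidHom.mem_ker, Isogeny.coe_toAddMonoidHom, map_sub, h1, hR₁, sub_self]⟩
      invFun := fun T => ⟨T.1 + R₁, by
        have h1 : langIsogeny W hσ T.1 = 0 := T.2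
        change langIsogeny W hσ (T.1 + R₁) = P
        rw [map_add, h1, hR₁, zero_add]⟩
      left_inv := fun R' => by simp
      right_inv := fun T => by simp }

include hσ in
/-- The Frobenius orbit of `R` is stable under `σ^j`. [folklore] -/
theorem pow_smul_mem_orbit {R P : W.geomPoints} (hR : R ≠ 0) (hP : P ∈ orbit W σ R) (j : ℕ) :
    (σ ^ j) • P ∈ orbit W σ R := by
  rw [mem_orbit_iff W σ hσ hR] at hP ⊢
  rw [belowPlace_smul, hP]

/-- **The decomposition law of a finite place in the Lang covering** (the hypothesis `hLang` of
`coordinateCharSumBound_of_langDecomposition`): for a place `v ≠ ∞` of `k(W)`, every place `w` of the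
Lang covering above `v` has degree `ord(pt v) · deg v`, and the number of such places times
`ord(pt v)` is `#W(k)`. Here `pt v = pointOfDivisor (single v 1)` is the sum of the Frobenius
conjugates of a geometric point above `v` (`toGeomPoints_pointOfDivisor_single`). Proof: the places
above `v` are the places below the `#W(k) · deg v` points `R'` with `ψ R' ∈ orbit(R)`
(`restrict_coverPlace`, `exists_langIsogeny_eq`, `card_fibre_langIsogeny`), which fall into
Frobenius orbits of size `deg v · ord(pt v)` (`degree_belowPlace_of_langIsogeny`), one orbit per
place. [cite: KohelShparlinski2000, §2] -/
theorem langDecomposition (v : PlaceOver F W.toAffine.FunctionField) (hv : v ≠ infPlace W.toAffine) :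
    (∀ w : PlaceOver F (LangCover W), w.restrict (K := F) (F := W.toAffine.FunctionField) = v →
        w.degree = addOrderOf (pointOfDivisor W.toAffine (Finsupp.single v 1)) * v.degree) ∧
      (v.finite_setOf_restrict_eq (F' := LangCover W)).toFinset.card *
          addOrderOf (pointOfDivisor W.toAffine (Finsupp.single v 1)) = Nat.card W.toAffine.Point := by
  obtain ⟨σ, hσ⟩ : ∃ σ : Field.absoluteGaloisGroup F, ∀ x : AlgebraicClosure F, σ • x = x ^ Nat.card F :=
    ⟨FiniteField.frobeniusAlgEquivOfAlgebraic F (AlgebraicClosure F), fun x => by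
      rw [Nat.card_eq_fintype_card]; rfl⟩
  obtain ⟨R₀, hR₀v⟩ := exists_belowPlace_eq W v
  have hR₀ : R₀ ≠ 0 := fun h0 => hv (hR₀v ▸ (belowPlace_eq_infPlace_iff W R₀).2 h0)
  set ψ := langIsogeny W hσ with hψdef
  set d := v.degree with hd
  set f := addOrderOf (orbitSum W σ R₀) with hf
  have hdpos : 0 < d := PlaceOver.degree_pos_holds _
  have hfpt : addOrderOf (pointOfDivisor W.toAffine (Finsupp.single v 1)) = f := by
    rw [hf, addOrderOf_orbitSum W hσ hR₀, hR₀v]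
  rw [hfpt]
  -- the degree of the place below a point `R'` with `ψ R' ∈ orbit R₀`
  have hdeg : ∀ R' : W.geomPoints, ψ R' ∈ orbit W σ R₀ → (belowPlace W R').degree = f * d := by
    intro R' hR'
    have hψ0 : ψ R' ≠ 0 := fun h0 => by
      rw [h0, mem_orbit_iff W σ hσ hR₀, belowPlace_zero] at hR'
      exact hv (hR₀v ▸ hR'.symm)
    have hbp : belowPlace W (ψ R') = v := hR₀v ▸ (mem_orbit_iff W σ hσ hR₀ _).1 hR'
    rw [degree_belowPlace_of_langIsogeny W hσ rfl hψ0, hbp, ← hd,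
      LangTorsorGeometric.orbitSum_eq_of_belowPlace_eq W σ (smul_eq_pow_fintypeCard hσ) hR₀ (hbp.trans hR₀v.symm), ← hf, mul_comm]
  -- a place above `v` is below a point `R'` with `ψ R' ∈ orbit R₀`
  have habove : ∀ w : PlaceOver F (LangCover W), w.restrict (K := F) (F := W.toAffine.FunctionField) = v →
      ∃ R' : W.geomPoints, ψ R' ∈ orbit W σ R₀ ∧ coverPlace W R' = w := by
    intro w hw
    obtain ⟨R', rfl⟩ := exists_coverPlace_eq W w
    rw [restrict_coverPlace W hσ R'] at hw
    exact ⟨R', (mem_orbit_iff W σ hσ hR₀ _).2 (hw.trans hR₀v.symm), rfl⟩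
  refine ⟨fun w hw => ?_, ?_⟩
  · obtain ⟨R', hR', rfl⟩ := habove w hw
    rw [degree_coverPlace]
    exact hdeg R' hR'
  -- counting: `X` = the points `R'` with `ψ R' ∈ orbit R₀`
  set S := (v.finite_setOf_restrict_eq (F' := LangCover W)).toFinset with hSdef
  have hS : ∀ w : PlaceOver F (LangCover W), w ∈ S ↔ w.restrict (K := F) (F := W.toAffine.FunctionField) = v :=
    fun w => v.mem_toFinset_restrict_eq_iff (F' := LangCover W) w
  set X : Finset W.geomPoints := (orbit W σ R₀).biUnion fun P => (ψ.finite_fibre P).toFinset with hXdef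
  have hmemX : ∀ R' : W.geomPoints, R' ∈ X ↔ ψ R' ∈ orbit W σ R₀ := fun R' => by
    rw [hXdef, Finset.mem_biUnion]
    constructor
    · rintro ⟨P, hP, hR'⟩
      rw [Set.Finite.mem_toFinset] at hR'
      change ψ R' = P at hR'
      rwa [hR']
    · intro h
      exact ⟨ψ R', h, by rw [Set.Finite.mem_toFinset]; rfl⟩
  -- `#X = d · n`
  have hXcard : X.card = d * Nat.card W.toAffine.Point := by
    rw [hXdef, Finset.card_biUnion]
    · rw [Finset.sum_congr rfl fun P hP => card_fibre_langIsogeny W hσ (P := P) (fun h0 => by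
        rw [h0, mem_orbit_iff W σ hσ hR₀, belowPlace_zero] at hP
        exact hv (hR₀v ▸ hP.symm)), Finset.sum_const, smul_eq_mul, card_orbit W σ hσ hR₀, hR₀v]
    · intro P₁ _ P₂ _ hne
      rw [Function.onFun, Finset.disjoint_left]
      intro R' h₁ h₂
      rw [Set.Finite.mem_toFinset] at h₁ h₂
      exact hne (h₁.symm.trans h₂)
  -- the map `X → S`, `R' ↦` the place below `R'`, and its fibres (Frobenius orbits of size `d f`)
  have hmaps : (X : Set W.geomPoints).MapsTo (coverPlace W) S := by
    intro R' hR'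
    rw [Finset.mem_coe, hmemX] at hR'
    rw [Finset.mem_coe, hS, restrict_coverPlace W hσ R', ← hR₀v]
    exact (mem_orbit_iff W σ hσ hR₀ _).1 hR'
  have hfibre : ∀ w ∈ S, (X.filter fun R' => coverPlace W R' = w).card = f * d := by
    intro w hw
    obtain ⟨R₁, hR₁, rfl⟩ := habove w ((hS w).1 hw)
    have hR₁0 : R₁ ≠ 0 := by
      intro h0
      rw [h0, map_zero, mem_orbit_iff W σ hσ hR₀, belowPlace_zero] at hR₁
      exact hv (hR₀v ▸ hR₁.symm)
    have heq : (X.filter fun R' => coverPlace W R' = coverPlace W R₁) = orbit W σ R₁ := by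
      ext R'
      rw [Finset.mem_filter, hmemX, mem_orbit_iff W σ hσ hR₁0, coverPlace_eq_coverPlace_iff]
      constructor
      · rintro ⟨-, h⟩; exact h
      · intro h
        refine ⟨?_, h⟩
        have hmem : R' ∈ orbit W σ R₁ := (mem_orbit_iff W σ hσ hR₁0 _).2 h
        rw [orbit, Finset.mem_image] at hmem
        obtain ⟨j, -, rfl⟩ := hmem
        rw [hψdef, langIsogeny_smul]
        exact pow_smul_mem_orbit W hσ hR₀ hR₁ j
    rw [heq, card_orbit W σ hσ hR₁0]
    exact hdeg R₁ hR₁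
  have hcount : X.card = S.card * (f * d) := by
    rw [Finset.card_eq_sum_card_fiberwise hmaps, Finset.sum_congr rfl hfibre, Finset.sum_const, smul_eq_mul]
  rw [hXcard] at hcount
  -- `d n = #S f d`
  have h1 : d * Nat.card W.toAffine.Point = d * (S.card * f) := by rw [hcount]; ring
  exact (Nat.eq_of_mul_eq_mul_left hdpos h1).symm

end Literature.NumberTheory.EllipticCurves.KohelShparlinski
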